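import Mathlib
import Summits.ResolutionOfSingularities.ResolutionOfSingularities.Theorems.RadicialJungCleanModelsValuationRefinement
import Literature.AlgebraicGeometry.Resolution.LocalBlowup
import HarnessLib

/-!
# Crux stmt-ResolutionOfSingularities-15917 (`RadicialJung.CleanModels`), skeleton `Sketch` rev 14, stub 4a
# `stub_cleanCharts3`: ZERO-DIMENSIONAL REFINEMENT of a valuation ring

Helper for the registered stub `stub_cleanCharts3` (clean charts) of `Cruxes/CleanModels/Lines/Sketch.lean` rev 14
(brief `Lines/Sketch-brief-stub_cleanCharts3.md`, step (i) of its route).  Clean local uniformization (`CleanLU3`)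
produces, at ONE valuation ring, a finitely generated model whose local ring AT THE CENTRE is clean-regular; to spread
this to a whole affine chart one wants the centre to be a CLOSED point of every model met on the way.  This file provides
the valuation-theoretic device: below any valuation subring `O` of a field `K` containing a subring `A` there is a
valuation subring `O₀ ≤ O` containing `A` such that the centre of `O₀` on EVERY subring `A ⊆ T ⊆ O₀` is a maximal
ideal (a «zero-dimensional» refinement: Zariski–Samuel VI §16, Abhyankar 1959 §2).

Construction: a MINIMAL element `O₀` of `{V | A ⊆ V ≤ O}` (Zorn: the intersection of a chain of valuation subrings
is a valuation subring); if the centre `𝔮` of `O₀` on `T` were not maximal, refining `O₀` to a valuation ring with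
centre a maximal ideal `𝔫 ⊋ 𝔮` (`exists_valuationSubring_le_centre_eq`, p659805, Chevalley) would contradict
minimality.

* `exists_valuationSubring_le_forall_centre_isMaximal` — the refinement;
* `locAtCentre_congr` — `locAtCentre B O` only depends on the centre of `O` on `B`;
* `locAtCentre_eq_of_le_of_le_locAtCentre` — `B ⊆ T ⊆ B_{𝔪_O ∩ B}` ⇒ `T_{𝔪_O ∩ T} = B_{𝔪_O ∩ B}`.

Pure valuation theory on top of Mathlib and two landed files; nothing here proves resolution in characteristic `p`.
-/

noncomputable section

set_option linter.dupNamespace false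

open IsLocalRing
open Literature.AlgebraicGeometry.Resolution

namespace Summit.ResolutionOfSingularities.ResolutionOfSingularities.Theorems.RadicialJung.CleanModels

/-- **The intersection of a non-empty chain of valuation subrings is a valuation subring.** [folklore] -/
theorem exists_valuationSubring_lowerBound_of_isChain {K : Type*} [Field K] (c : Set (ValuationSubring K))
    (hc : IsChain (· ≤ ·) c) (hne : c.Nonempty) :
    ∃ V : ValuationSubring K, (∀ W ∈ c, V ≤ W) ∧ ∀ x : K, (∀ W ∈ c, x ∈ W) → x ∈ V := by
  classical
  obtain ⟨W₀, hW₀⟩ := hne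
  let V : ValuationSubring K :=
    { carrier := {x | ∀ W ∈ c, x ∈ W}
      mul_mem' := fun hx hy W hW => W.toSubring.mul_mem (hx W hW) (hy W hW)
      one_mem' := fun W _ => W.toSubring.one_mem
      add_mem' := fun hx hy W hW => W.toSubring.add_mem (hx W hW) (hy W hW)
      zero_mem' := fun W _ => W.toSubring.zero_mem
      neg_mem' := fun hx W hW => W.toSubring.neg_mem (hx W hW)
      mem_or_inv_mem' := by
        intro x
        by_cases h : ∀ W ∈ c, x ∈ W
        · exact Or.inl h
        · right
          push Not at h
          obtain ⟨W₁, hW₁, hx⟩ := h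
          intro W hW
          rcases hc.total hW₁ hW with h | h
          · exact h ((W₁.mem_or_inv_mem x).resolve_left hx)
          · exact (W.mem_or_inv_mem x).resolve_left fun hxW => hx (h hxW) }
  exact ⟨V, fun W hW x hx => hx W hW, fun x hx => hx⟩

/-- **Zero-dimensional refinement of a valuation ring.**  Let `O` be a valuation subring of a field `K` and `A ⊆ O` a
subring.  Then there is a valuation subring `O₀ ≤ O` containing `A` such that for EVERY subring `T` with
`A ⊆ T ⊆ O₀` the centre `𝔪_{O₀} ∩ T` of `O₀` on `T` is a maximal ideal of `T` (take `O₀` minimal among the valuation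
subrings between `A` and `O`; Zariski–Samuel VI §16). [cite: Matsumura1987, Thm. 10.2 and §10] -/
theorem exists_valuationSubring_le_forall_centre_isMaximal {K : Type*} [Field K] (O : ValuationSubring K)
    (A : Subring K) (hA : A ≤ O.toSubring) :
    ∃ O₀ : ValuationSubring K, O₀ ≤ O ∧ A ≤ O₀.toSubring ∧
      ∀ (T : Subring K) (hT : T ≤ O₀.toSubring), A ≤ T → (subringCentre T O₀ hT).IsMaximal := by
  classical
  -- a minimal valuation subring between `A` and `O`
  let S : Set (ValuationSubring K) := {V | A ≤ V.toSubring ∧ V ≤ O}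
  have hOS : O ∈ S := ⟨hA, le_rfl⟩
  obtain ⟨O₀, ⟨hAO₀, hO₀O⟩, hmin⟩ : ∃ m, Minimal (· ∈ S) m := by
    refine @zorn_le₀ (ValuationSubring K)ᵒᵈ _ S fun c hcS hc => ?_
    rcases c.eq_empty_or_nonempty with rfl | hne
    · exact ⟨O, hOS, fun z hz => hz.elim⟩
    · obtain ⟨V, hVle, hVmem⟩ := exists_valuationSubring_lowerBound_of_isChain c hc.symm hne
      obtain ⟨W₀, hW₀⟩ := hne
      refine ⟨V, ⟨fun x hx => hVmem x fun W hW => (hcS hW).1 hx, fun x hx => (hcS hW₀).2 (hVle W₀ hW₀ hx)⟩,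
        fun z hz => hVle z hz⟩
  refine ⟨O₀, hO₀O, hAO₀, fun T hT hAT => ?_⟩
  -- the centre `𝔮` of `O₀` on `T`; a maximal ideal `𝔫 ⊇ 𝔮`
  obtain ⟨𝔫, h𝔫, h𝔮𝔫⟩ := Ideal.exists_le_maximal (subringCentre T O₀ hT) Ideal.IsPrime.ne_top'
  have hcentre : ∀ a : T, O₀.valuation (a : K) < 1 → a ∈ 𝔫 :=
    fun a ha => h𝔮𝔫 ((mem_subringCentre_iff hT a).mpr ha)
  -- refine `O₀` to a valuation ring with centre `𝔫`; by minimality it is `O₀` itself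
  obtain ⟨O₁, hO₁O₀, hTO₁, hc𝔫⟩ := exists_valuationSubring_le_centre_eq O₀ T hT 𝔫 hcentre
  have hO₁S : O₁ ∈ S := ⟨hAT.trans hTO₁, hO₁O₀.trans hO₀O⟩
  have hO₀O₁ : O₀ ≤ O₁ := hmin hO₁S hO₁O₀
  have heq : subringCentre T O₀ hT = 𝔫 := by
    ext a
    rw [mem_subringCentre_iff, hc𝔫]
    have h01 : O₁ = O₀ := le_antisymm hO₁O₀ hO₀O₁
    rw [h01]
  rw [heq]
  exact h𝔫

/-- **`locAtCentre B O` only depends on the centre of `O` on `B`**: if two valuation subrings `O, O' ⊇ B` have the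
same centre on `B`, the two localisations coincide inside `K`. [folklore] -/
theorem locAtCentre_congr {K : Type*} [Field K] {B : Subring K} {O O' : ValuationSubring K}
    (hB : B ≤ O.toSubring) (hB' : B ≤ O'.toSubring)
    (h : ∀ b : B, O.valuation (b : K) < 1 ↔ O'.valuation (b : K) < 1) :
    locAtCentre B O = locAtCentre B O' := by
  have key : ∀ {O O' : ValuationSubring K}, B ≤ O.toSubring → B ≤ O'.toSubring →
      (∀ b : B, O.valuation (b : K) < 1 ↔ O'.valuation (b : K) < 1) → locAtCentre B O ≤ locAtCentre B O' := by
    intro O O' hB hB' h x hx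
    obtain ⟨y, hy, z, hz, hvz, rfl⟩ := (mem_locAtCentre_iff).mp hx
    refine (mem_locAtCentre_iff).mpr ⟨y, hy, z, hz, ?_, rfl⟩
    have hz1 : ¬ O'.valuation z < 1 := fun hlt => by
      have := (h ⟨z, hz⟩).mpr hlt
      rw [hvz] at this
      exact lt_irrefl _ this
    exact le_antisymm ((O'.valuation_le_one_iff z).mpr (hB' hz)) (not_lt.mp hz1)
  exact le_antisymm (key hB hB' h) (key hB' hB fun b => (h b).symm)

/-- **Sandwiched rings have the same local ring at the centre**: if `B ⊆ T ⊆ B_{𝔪_O ∩ B}` inside `K` then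
`T_{𝔪_O ∩ T} = B_{𝔪_O ∩ B}`. [folklore] -/
theorem locAtCentre_eq_of_le_of_le_locAtCentre {K : Type*} [Field K] {B T : Subring K} (O : ValuationSubring K)
    (hBT : B ≤ T) (hT : T ≤ locAtCentre B O) : locAtCentre T O = locAtCentre B O :=
  le_antisymm (le_trans (locAtCentre_mono O hT) (le_of_eq (locAtCentre_locAtCentre B O)))
    (locAtCentre_mono O hBT)

/-- An element of `B` of value `1` has its inverse in `B_{𝔪_O ∩ B}`. [folklore] -/
theorem inv_mem_locAtCentre_of_mem {K : Type*} [Field K] {B : Subring K} {O : ValuationSubring K} {h : K}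
    (hh : h ∈ B) (hv : O.valuation h = 1) : h⁻¹ ∈ locAtCentre B O :=
  inv_mem_locAtCentre (le_locAtCentre B O hh) hv

end Summit.ResolutionOfSingularities.ResolutionOfSingularities.Theorems.RadicialJung.CleanModels

end
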